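import Summits.Parity.GeneralizedHardyLittlewood.Theses.FordMaynardSieveConst01651
import Summits.Parity.GeneralizedHardyLittlewood.Theorems.FordMaynardSieveConst01651Assembly
import HarnessLib

/-!
# Line `cone_table_bridge` — target `SieveConst01651` (rank 0) of route `FordMaynardSieveConst01651`
(Parity / GeneralizedHardyLittlewood; item stmt-Parity-19185; line-writer seat
`linewriter-parity-smallroutes-1` g0, 2026-08-31)

LINE (the route's standard road, re-cut at the two LEAF stubs).
`SieveConst01651 = LowerSieveThresholdAt (1651/10000)` (for every `ν ∈ [0.1651, 1/3)` some `c > 0` is an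
admissible lower-bound linear-sieve constant at `(1/2, 0, ν)`)
  ⇐ `stub_coneCert` (ccert, XL: the `(𝟙⋆g)`-certificate on ORDERED-cone data `g₀` at `ν = 0.1651` — the SAME
    registered stub as line `cone_table` of the crux `GCert01651`, stmt-Parity-19186; one proof closes both)
  + `stub_fm73aLevelHalf` (print, XL: the named Literature fact Ford–Maynard Theorem 7.3 (a) at
    `P = (1/2, 0, ν)` = the route's declared CONDITIONAL BRIDGE = support item `FMThm73aLevelHalf`,
    stmt-Parity-19187, BY NAME; closing it = formalising FM §7)
  via the PROVED symmetrisation (`symmExt`, `starSum_perm`, copied from line `cone_table` so that this file is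
  self-contained) giving `GCert01651`, and the LANDED assembly `assembly_holds`
  (`Theorems/FordMaynardSieveConst01651Assembly.lean`: `FordMaynard2024_thm73a_levelHalf.exists_pos` at
  `ν = 0.1651`, then `IsLowerSieveConst.mono`).
HONEST: this is the target's by-name road (`closes hA h1 h2`) with `h1` replaced by the leaf-level certificate
stub; it adds no mathematics beyond line `cone_table`; line supply, kit 0.
-/

noncomputable section

open Finset
open Literature.NumberTheory.Sieve Literature.NumberTheory.Sieve.FordMaynard

namespace Summit.Parity.GeneralizedHardyLittlewood.Cruxes.SieveConst01651.ConeTableBridge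

/-! ### Symmetric extension from the ordered cone -/

/-- The symmetric extension of cone data: `symmExt g₀ k x = g₀ k (x sorted increasingly)`. -/
def symmExt (g₀ : VecFn) : VecFn := fun k x => g₀ k (x ∘ ⇑(Tuple.sort x))

theorem symmExt_perm (g₀ : VecFn) (k : ℕ) (σ : Equiv.Perm (Fin k)) (x : Fin k → ℝ) :
    symmExt g₀ k (x ∘ σ) = symmExt g₀ k x := by
  simp only [symmExt]
  rw [Tuple.comp_perm_comp_sort_eq_comp_sort]

/-- `symmExt g₀ ∈ 𝒮` (Definition 6.1). -/
theorem isSymmetric_symmExt (g₀ : VecFn) : (symmExt g₀).IsSymmetric :=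
  fun k σ x => symmExt_perm g₀ k σ x

/-- On ordered vectors the extension is the data. -/
theorem symmExt_of_monotone (g₀ : VecFn) {k : ℕ} {x : Fin k → ℝ} (hx : Monotone x) :
    symmExt g₀ k x = g₀ k x := by
  simp only [symmExt]
  rw [Tuple.sort_eq_refl_iff_monotone.mpr hx]
  simp

/-- On ordered vectors `starSum (symmExt g₀) = starSum g₀` (ordered subvectors of an ordered vector
are ordered). -/
theorem starSum_symmExt_of_monotone (g₀ : VecFn) {k : ℕ} {x : Fin k → ℝ} (hx : Monotone x) :
    starSum (symmExt g₀) k x = starSum g₀ k x := by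
  unfold starSum
  refine Finset.sum_congr rfl fun A _ => ?_
  exact symmExt_of_monotone g₀ (hx.comp (A.orderEmbOfFin rfl).monotone)

/-- The sieve bound only reads ordered vectors: `sieveBoundG1 ν (symmExt g₀) = sieveBoundG1 ν g₀`. -/
theorem sieveBoundG1_symmExt (ν : ℝ) (g₀ : VecFn) :
    sieveBoundG1 ν (symmExt g₀) = sieveBoundG1 ν g₀ := by
  unfold sieveBoundG1
  congr 1
  refine Finset.sum_congr rfl fun k _ => ?_
  congr 1
  funext x
  split_ifs with h
  · rw [starSum_symmExt_of_monotone g₀ h.2]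
  · rfl

/-- `IsPiecewiseConstOnCone` only reads ordered vectors. -/
theorem isPiecewiseConstOnCone_symmExt {g₀ : VecFn} (h : IsPiecewiseConstOnCone g₀) :
    IsPiecewiseConstOnCone (symmExt g₀) := by
  intro k
  obtain ⟨m, P, c, hP, hg⟩ := h k
  exact ⟨m, P, c, hP, fun x hx => by rw [symmExt_of_monotone g₀ hx]; exact hg x hx⟩

/-- The support condition transfers from ordered vectors to all vectors. -/
theorem support_symmExt {ν : ℝ} {g₀ : VecFn}
    (h : ∀ (k : ℕ) (x : Fin k → ℝ), Monotone x → g₀ k x ≠ 0 →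
      k = 0 ∨ ((∀ i, ν < x i) ∧ ∑ i, x i < 1 / 2)) :
    ∀ (k : ℕ) (x : Fin k → ℝ), symmExt g₀ k x ≠ 0 →
      k = 0 ∨ ((∀ i, ν < x i) ∧ ∑ i, x i < 1 / 2) := by
  intro k x hne
  have hmono : Monotone (x ∘ ⇑(Tuple.sort x)) := Tuple.monotone_sort x
  rcases h k _ hmono hne with h0 | ⟨hall, hsum⟩
  · exact Or.inl h0
  · refine Or.inr ⟨fun i => ?_, ?_⟩
    · simpa using hall ((Tuple.sort x).symm i)
    · have : (∑ i, (x ∘ ⇑(Tuple.sort x)) i) = ∑ i, x i := by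
        simp only [Function.comp_apply]
        exact Equiv.sum_comp (Tuple.sort x) x
      rwa [this] at hsum

/-! ### Permutation invariance of `starSum` for symmetric `g` -/

/-- Changing the proof of `B.card = n` / the index `n` along it does not change the `g`-value of the
ordered listing of `x` on `B`. -/
theorem apply_orderEmb_cast (g : VecFn) {k : ℕ} (x : Fin k → ℝ) (B : Finset (Fin k)) {n : ℕ}
    (h : B.card = n) :
    g n (fun i => x (B.orderEmbOfFin h i)) = g B.card (fun i => x (B.orderEmbOfFin rfl i)) := by
  subst h; rfl

/-- For symmetric `g`, the `g`-value of `x` listed along ANY injective enumeration of a finite index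
set `B` equals its value along the increasing enumeration. -/
theorem apply_comp_eq_of_range {g : VecFn} (hs : g.IsSymmetric) {k : ℕ} (x : Fin k → ℝ)
    (B : Finset (Fin k)) {n : ℕ} (hB : B.card = n) (f : Fin n → Fin k)
    (hf : Function.Injective f) (hmem : ∀ i, f i ∈ B) :
    g n (x ∘ f) = g n (fun i => x (B.orderEmbOfFin hB i)) := by
  let π₀ : Fin n → Fin n := fun i => (B.orderIsoOfFin hB).symm ⟨f i, hmem i⟩
  have hπ₀ : Function.Injective π₀ := by
    intro i j hij
    have h1 := congrArg (fun t => ((B.orderIsoOfFin hB) t : Fin k)) hij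
    simp only [π₀, OrderIso.apply_symm_apply] at h1
    exact hf h1
  let π : Equiv.Perm (Fin n) := Equiv.ofBijective π₀ (Finite.injective_iff_bijective.mp hπ₀)
  have hcomp : (fun i => x (B.orderEmbOfFin hB i)) ∘ ⇑π = x ∘ f := by
    funext i
    simp only [Function.comp_apply, π, Equiv.ofBijective_apply, π₀]
    rw [← Finset.coe_orderIsoOfFin_apply, OrderIso.apply_symm_apply]
  rw [← hcomp, hs n π]

/-- **`(𝟙⋆g)` is permutation invariant for `g ∈ 𝒮`** (Definition 7.1 with Definition 6.1):
`starSum g k (x ∘ σ) = starSum g k x`. -/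
theorem starSum_perm {g : VecFn} (hs : g.IsSymmetric) (k : ℕ) (σ : Equiv.Perm (Fin k))
    (x : Fin k → ℝ) : starSum g k (x ∘ σ) = starSum g k x := by
  unfold starSum
  rw [← Equiv.sum_comp (Equiv.finsetCongr σ)
    (fun B : Finset (Fin k) => g B.card (fun i => x (B.orderEmbOfFin rfl i)))]
  refine Finset.sum_congr rfl fun A _ => ?_
  have hB : ((Equiv.finsetCongr σ) A).card = A.card := by
    simp only [Equiv.finsetCongr_apply, Finset.card_map]
  have hmem : ∀ i, (⇑σ ∘ ⇑(A.orderEmbOfFin rfl)) i ∈ (Equiv.finsetCongr σ) A := by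
    intro i
    simp only [Function.comp_apply, Equiv.finsetCongr_apply, Finset.mem_map_equiv,
      Equiv.symm_apply_apply]
    exact A.orderEmbOfFin_mem rfl i
  have key := apply_comp_eq_of_range hs x ((Equiv.finsetCongr σ) A) hB
    (⇑σ ∘ ⇑(A.orderEmbOfFin rfl)) (σ.injective.comp (A.orderEmbOfFin rfl).injective) hmem
  rw [apply_orderEmb_cast g x ((Equiv.finsetCongr σ) A) hB] at key
  exact key

/-! ### The `ℋ`-inequality: from ordered vectors in dimensions `2 … 6` to all vectors -/

/-- No vector of dimension `k ≥ 7` has all components `> 1651/10000` and sum `1`. -/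
theorem dim_le_six {k : ℕ} {x : Fin k → ℝ} (hbox : ∀ i, (1651 / 10000 : ℝ) < x i)
    (hsum : ∑ i, x i = 1) : k ≤ 6 := by
  by_contra hk
  have hk7 : 7 ≤ k := by omega
  have hlt : ∑ _i : Fin k, (1651 / 10000 : ℝ) < ∑ i, x i := by
    haveI : Nonempty (Fin k) := ⟨⟨0, by omega⟩⟩
    exact Finset.sum_lt_sum_of_nonempty Finset.univ_nonempty fun i _ => hbox i
  rw [Finset.sum_const, Finset.card_univ, Fintype.card_fin, nsmul_eq_mul, hsum] at hlt
  have : (7 : ℝ) ≤ k := by exact_mod_cast hk7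
  nlinarith

/-- The `ℋ`-inequality for `symmExt g₀` at every `x`, from the inequality for `g₀` at ordered `x` in
dimensions `2 ≤ k ≤ 6`. -/
theorem starSum_nonpos_of_cone {g₀ : VecFn}
    (hH : ∀ k : ℕ, 2 ≤ k → k ≤ 6 → ∀ x : Fin k → ℝ, Monotone x →
      (∀ i, (1651 / 10000 : ℝ) < x i ∧ x i < 1 - 1651 / 10000) → ∑ i, x i = 1 →
        starSum g₀ k x ≤ 0) :
    ∀ k : ℕ, 2 ≤ k → ∀ x : Fin k → ℝ,
      (∀ i, (1651 / 10000 : ℝ) < x i ∧ x i < 1 - 1651 / 10000) → ∑ i, x i = 1 →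
        starSum (symmExt g₀) k x ≤ 0 := by
  intro k hk x hbox hsum
  have hk6 : k ≤ 6 := dim_le_six (fun i => (hbox i).1) hsum
  rw [← starSum_perm (isSymmetric_symmExt g₀) k (Tuple.sort x) x,
    starSum_symmExt_of_monotone g₀ (Tuple.monotone_sort x)]
  refine hH k hk hk6 _ (Tuple.monotone_sort x) (fun i => hbox _) ?_
  have : (∑ i, (x ∘ ⇑(Tuple.sort x)) i) = ∑ i, x i := by
    simp only [Function.comp_apply]
    exact Equiv.sum_comp (Tuple.sort x) x
  rw [this, hsum]

/-! ### The stubs and the composition -/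

/-- Stub statement 1: the certificate on CONE DATA at `ν = 1651/10000` (identical to
`Cruxes.GCert01651.ConeTable.Signature.stub_coneCert`). -/
def Signature.stub_coneCert : Prop :=
  ∃ g₀ : VecFn, IsPiecewiseConstOnCone g₀ ∧ (∀ e : Fin 0 → ℝ, g₀ 0 e = 1) ∧
    (∀ (k : ℕ) (x : Fin k → ℝ), Monotone x → g₀ k x ≠ 0 →
      k = 0 ∨ ((∀ i, (1651 / 10000 : ℝ) < x i) ∧ ∑ i, x i < 1 / 2)) ∧
    (∀ k : ℕ, 2 ≤ k → k ≤ 6 → ∀ x : Fin k → ℝ, Monotone x →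
      (∀ i, (1651 / 10000 : ℝ) < x i ∧ x i < 1 - 1651 / 10000) → ∑ i, x i = 1 →
        starSum g₀ k x ≤ 0) ∧
    0 < sieveBoundG1 (1651 / 10000) g₀

/-- Stub statement 2: the named fact Ford–Maynard Theorem 7.3 (a) at level `1/2` (= item `FMThm73aLevelHalf`). -/
def Signature.stub_fm73aLevelHalf : Prop :=
  FordMaynard2024_thm73a_levelHalf

/-- **Open stub 1** (XL, ccert): the cone-data certificate (shared with line `cone_table` of `GCert01651`). -/
theorem stub_coneCert :
    ∃ g₀ : VecFn, IsPiecewiseConstOnCone g₀ ∧ (∀ e : Fin 0 → ℝ, g₀ 0 e = 1) ∧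
      (∀ (k : ℕ) (x : Fin k → ℝ), Monotone x → g₀ k x ≠ 0 →
        k = 0 ∨ ((∀ i, (1651 / 10000 : ℝ) < x i) ∧ ∑ i, x i < 1 / 2)) ∧
      (∀ k : ℕ, 2 ≤ k → k ≤ 6 → ∀ x : Fin k → ℝ, Monotone x →
        (∀ i, (1651 / 10000 : ℝ) < x i ∧ x i < 1 - 1651 / 10000) → ∑ i, x i = 1 →
          starSum g₀ k x ≤ 0) ∧
      0 < sieveBoundG1 (1651 / 10000) g₀ := by
  sorry

/-- **Open stub 2** (XL, print): Ford–Maynard Theorem 7.3 (a) at `P = (1/2, 0, ν)`, `0 < ν < 1/4`, for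
symmetric piecewise-constant `g` — the route's declared conditional bridge (named Literature fact
`FordMaynard2024_thm73a_levelHalf`, arXiv:2407.14368 Thm 7.3 (a) with (7.1), Lemma 8.4; unformalised, §7). -/
theorem stub_fm73aLevelHalf : FordMaynard2024_thm73a_levelHalf := by
  sorry

example : Signature.stub_coneCert := stub_coneCert
example : Signature.stub_fm73aLevelHalf := stub_fm73aLevelHalf

/-- From the cone-data certificate to the route crux `GCert01651` (proved symmetrisation). -/
theorem gCert_of_coneCert (h : Signature.stub_coneCert) :
    Summit.Parity.GeneralizedHardyLittlewood.Theses.FordMaynardSieveConst01651.GCert01651 := by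
  obtain ⟨g₀, hpc, h0, hsupp, hH, hV⟩ := h
  refine ⟨symmExt g₀, isSymmetric_symmExt g₀, isPiecewiseConstOnCone_symmExt hpc, fun e => h0 _,
    support_symmExt hsupp, starSum_nonpos_of_cone hH, ?_⟩
  rw [sieveBoundG1_symmExt]
  exact hV

/-- **Composition (kernel-checked)**: the two leaf stubs give the ROUTE TARGET BY NAME, through the proved
symmetrisation and the landed `assembly_holds`. -/
theorem SieveConst01651_of :
    Signature.stub_coneCert → Signature.stub_fm73aLevelHalf →
      Summit.Parity.GeneralizedHardyLittlewood.Theses.FordMaynardSieveConst01651.SieveConst01651 :=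
  fun h1 h2 =>
    Summit.Parity.GeneralizedHardyLittlewood.Theses.FordMaynardSieveConst01651.assembly_holds
      (gCert_of_coneCert h1) h2

/-- **The skeleton instantiated**: the target BY NAME modulo the two registered stubs. -/
theorem SieveConst01651_of_stubs :
    Summit.Parity.GeneralizedHardyLittlewood.Theses.FordMaynardSieveConst01651.SieveConst01651 :=
  SieveConst01651_of stub_coneCert stub_fm73aLevelHalf

end Summit.Parity.GeneralizedHardyLittlewood.Cruxes.SieveConst01651.ConeTableBridge

end
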